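import Summits.KontsevichZagierPeriods.KontsevichZagierPeriods.Theorems.CurvePeriodsTransfer.Negative.LoadBearing
import Summits.KontsevichZagierPeriods.KontsevichZagierPeriods.Theorems.RealOnePeriodRelations.Negative.GreenSound
import Literature.NumberTheory.Transcendental.KZSubcalculusInvariants
import Summits.KontsevichZagierPeriods.KontsevichZagierPeriods.Theorems.SymplecticScissorsCurvePeriodsTransferRecord

-- buildfix 2026-08-20 (ops-buildfix lane, proof-only): `SymplecticScissors.CurvePeriodsTransfer` (stmt-11129) was dropped from
-- the generated route file on 2026-08-16T14:16Z (items-cap autofix); the landed record module imported above re-declares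
-- it (and `PeriodConjectureCurveType`) under the ORIGINAL fully-qualified name with the ledger signature verbatim, so the
-- `open … (CurvePeriodsTransfer RealOnePeriodRelations)` line and every statement below elaborate textually unchanged.

/-!
# `CurvePeriodsTransfer` (stmt-KontsevichZagierPeriods-11129) — negative knowledge, part 3: the consequent — only dimension-one moves matter, and rule (2) cannot be dropped

Support file for the crux `SymplecticScissors.CurvePeriodsTransfer` (its consequent is the sibling crux
`SymplecticScissors.RealOnePeriodRelations`, stmt-10042) (cdisprove seat of 11129, cycle 1; work file
`Cruxes/CurvePeriodsTransfer/Disproof.lean`). The vocabulary `greenSet`, `M₁`, `H₁`, `crux_iff`,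
`constRep₁`, `unitDom` and the soundness `eval_eq_zero_of_mem_greenSet` / `M₁_le_ker_eval` are those of
the sibling's landed kit (`Theorems/RealOnePeriodRelations/Negative/Kit.lean`, `GreenSound.lean`) — one
`M₁` for both Negative folders. The load-bearing tests of the consequent's OWN two hypotheses (`eval c = 0`,
`c ∈ H₁`) belong to the sibling seat and are not repeated here. Contents:

* §1 THE DIMENSION FILTER `dimFilter d : FormalRep →+ FormalRep` (keep the generators of dimension `d`,
  kill the others). The moves 1a/1b/2 are dimension-homogeneous and Green lives in dimension `1`, so
  `dimFilter d` maps `M₁` into `KZ.relations` for `d ≠ 1` (`dimFilter_mem_relations_of_mem_M₁`), and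
  `dimFilter 1` retracts `M₁` onto the subgroup `M₁'` generated by the DIMENSION-ONE instances
  `domainAddRel₁ ∪ integrandAddRel₁ ∪ changeOfVariablesRel₁ ∪ greenSet` while fixing `H₁`. Hence the
  STRUCTURE LEMMA FOR PROVERS `realOnePeriodRelations_iff_dimOne` / `transfer_iff_dimOne`: the consequent
  (and the crux) are equivalent to their versions with conclusion subgroup `M₁'` — a proof may ignore
  every other dimension.
* §2 A REFUTED WEAKENING of the conclusion subgroup: `closure (1a ∪ 1b ∪ Green)` (rule (2) dropped) is
  NOT enough (`consequent_false_without_changeOfVariables`): `[∫_{(0,2)} ½] − [∫_{(0,1)} 1]` lies in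
  `H₁`, evaluates to `0` (it is one scaling instance of rule (2)), and is separated from
  `closure (1a ∪ 1b ∪ Green)` by the unit-cube-restricted evaluation `KZ.restrictedEval cubeWindow`
  (tree `KZSubcalculusInvariants`: the additivity moves respect every windowed evaluation; Green respects
  the unit-cube window because its three domains ARE the window and it is sound). So "additivity + Green"
  is not a complete subcalculus in dimension one: any proof uses rule (2) (where R3 and reparametrisations
  of the Huber–Wüstholz certificate land).
-/

noncomputable section

open scoped BigOperators
open Set MeasureTheory MvPolynomial
open Literature.NumberTheory.Transcendental
open Literature.ModelTheory.ExponentialFields (IsSemialgebraic)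
open Summit.KontsevichZagierPeriods.KontsevichZagierPeriods.Theses.SymplecticScissors
  (CurvePeriodsTransfer RealOnePeriodRelations)
open Summit.KontsevichZagierPeriods.SymplecticScissors.RealOnePeriodRelationsNegative
  (greenSet M₁ H₁ crux_iff unitDom constRep₁ constRep₁_domain value_constRep₁ volume_unitDom
    isSemialgebraicFunOn_ratConst eval_eq_zero_of_mem_greenSet M₁_le_ker_eval)

namespace Summit.KontsevichZagierPeriods.SymplecticScissors.CurvePeriodsTransferNegative

/-! ## §1 The dimension filter; only dimension-one instances of the moves matter -/

/-- The dimension filter: the endomorphism of `FormalRep` keeping the generators of dimension `d` and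
killing the others. [folklore] -/
def dimFilter (d : ℕ) : KZ.FormalRep →+ KZ.FormalRep :=
  FreeAbelianGroup.lift fun x => if x.1 = d then FreeAbelianGroup.of x else 0

/-- The dimension filter on a generator. [folklore] -/
theorem dimFilter_of {n : ℕ} (d : ℕ) (r : KZ.IntegralRep n) :
    dimFilter d (KZ.of r) = if n = d then KZ.of r else 0 :=
  FreeAbelianGroup.lift_apply_of _ _

/-- The dimension filter fixes generators of its own dimension. [folklore] -/
theorem dimFilter_of_self {d : ℕ} (r : KZ.IntegralRep d) : dimFilter d (KZ.of r) = KZ.of r := by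
  rw [dimFilter_of, if_pos rfl]

/-- The dimension filter kills generators of other dimensions. [folklore] -/
theorem dimFilter_of_ne {n d : ℕ} (h : n ≠ d) (r : KZ.IntegralRep n) : dimFilter d (KZ.of r) = 0 := by
  rw [dimFilter_of, if_neg h]

/-- `dimFilter 1` is the identity on `H₁`. [folklore] -/
theorem dimFilter_one_eq_self_of_mem_H₁ {c : KZ.FormalRep} (hc : c ∈ H₁) : dimFilter 1 c = c := by
  refine AddSubgroup.closure_induction (fun x hx => ?_) (map_zero _) (fun x y _ _ hx hy => ?_)
    (fun x _ hx => ?_) hc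
  · obtain ⟨r, rfl⟩ := hx
    exact dimFilter_of_self r
  · rw [map_add, hx, hy]
  · rw [map_neg, hx]

/-- `dimFilter d` maps every move of the three dimension-homogeneous families to a move of the same
family or to `0`, and for `d ≠ 1` it kills the Green generator; hence it maps `M₁` into `KZ.relations`
when `d ≠ 1` (so every fixed-dimension part of an element of `M₁` evaluates to `0`). [folklore] -/
theorem dimFilter_mem_relations_of_mem_M₁ {d : ℕ} (hd : d ≠ 1) {c : KZ.FormalRep} (hc : c ∈ M₁) :
    dimFilter d c ∈ KZ.relations := by
  refine AddSubgroup.closure_induction (fun g hg => ?_) (by simp [KZ.relations.zero_mem])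
    (fun x y _ _ hx hy => by rw [map_add]; exact KZ.relations.add_mem hx hy)
    (fun x _ hx => by rw [map_neg]; exact KZ.relations.neg_mem hx) hc
  rcases hg with ((hg | hg) | hg) | hg
  · obtain ⟨n, r, r₁, r₂, h1, h2, h3, h4, rfl⟩ := hg
    by_cases hn : n = d
    · subst hn
      simp only [map_sub, dimFilter_of_self]
      exact KZ.domainAddRel_subset_relations ⟨_, r, r₁, r₂, h1, h2, h3, h4, rfl⟩
    · simp [map_sub, dimFilter_of_ne hn, KZ.relations.zero_mem]
  · obtain ⟨n, r, r₁, r₂, h1, h2, h3, rfl⟩ := hg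
    by_cases hn : n = d
    · subst hn
      simp only [map_sub, dimFilter_of_self]
      exact KZ.integrandAddRel_subset_relations ⟨_, r, r₁, r₂, h1, h2, h3, rfl⟩
    · simp [map_sub, dimFilter_of_ne hn, KZ.relations.zero_mem]
  · obtain ⟨n, r, r', Φ, Φ', h1, h2, h3, h4, h5, rfl⟩ := hg
    by_cases hn : n = d
    · subst hn
      simp only [map_sub, dimFilter_of_self]
      exact KZ.changeOfVariablesRel_subset_relations ⟨_, r, r', Φ, Φ', h1, h2, h3, h4, h5, rfl⟩
    · simp [map_sub, dimFilter_of_ne hn, KZ.relations.zero_mem]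
  · obtain ⟨Δ, A, B, S, r₀₁, r₁₂, r₀₂, -, -, -, -, -, -, -, -, -, -, -, -, rfl⟩ := hg
    simp [map_sub, map_add, dimFilter_of_ne hd.symm, KZ.relations.zero_mem]

/-- Dimension-one instances of domain additivity (1a). [cite: KontsevichZagier2001, §1.2 rule (1)] -/
def domainAddRel₁ : Set KZ.FormalRep :=
  {c | ∃ (r r₁ r₂ : KZ.IntegralRep 1), r.domain = r₁.domain ∪ r₂.domain ∧
    volume (r₁.domain ∩ r₂.domain) = 0 ∧ EqOn r.integrand r₁.integrand r₁.domain ∧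
    EqOn r.integrand r₂.integrand r₂.domain ∧ c = KZ.of r - KZ.of r₁ - KZ.of r₂}

/-- Dimension-one instances of integrand additivity (1b). [cite: KontsevichZagier2001, §1.2 rule (1)] -/
def integrandAddRel₁ : Set KZ.FormalRep :=
  {c | ∃ (r r₁ r₂ : KZ.IntegralRep 1), r₁.domain = r.domain ∧ r₂.domain = r.domain ∧
    EqOn r.integrand (r₁.integrand + r₂.integrand) r.domain ∧ c = KZ.of r - KZ.of r₁ - KZ.of r₂}

/-- Dimension-one instances of change of variables (2). [cite: KontsevichZagier2001, §1.2 rule (2)] -/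
def changeOfVariablesRel₁ : Set KZ.FormalRep :=
  {c | ∃ (r r' : KZ.IntegralRep 1) (Φ : (Fin 1 → ℝ) → (Fin 1 → ℝ))
      (Φ' : (Fin 1 → ℝ) → (Fin 1 → ℝ) →L[ℝ] (Fin 1 → ℝ)),
    IsSemialgebraicMapOn ℚ r.domain Φ ∧ (∀ x ∈ r.domain, HasFDerivWithinAt Φ (Φ' x) r.domain x) ∧
    InjOn Φ r.domain ∧ r'.domain = Φ '' r.domain ∧
    (∀ x ∈ r.domain, r.integrand x = r'.integrand (Φ x) * |(Φ' x).det|) ∧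
    c = KZ.of r - KZ.of r'}

/-- `M₁'`: the subgroup generated by the DIMENSION-ONE instances of 1a, 1b, 2 and Green.
[cite: KontsevichZagier2001, §1.2] -/
def M₁' : AddSubgroup KZ.FormalRep :=
  AddSubgroup.closure (domainAddRel₁ ∪ integrandAddRel₁ ∪ changeOfVariablesRel₁ ∪ greenSet)

/-- `M₁' ≤ M₁`. [folklore] -/
theorem M₁'_le_M₁ : M₁' ≤ M₁ := by
  refine (AddSubgroup.closure_le _).mpr ?_
  rintro c (((hc | hc) | hc) | hc)
  · obtain ⟨r, r₁, r₂, h1, h2, h3, h4, rfl⟩ := hc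
    exact AddSubgroup.subset_closure (Or.inl (Or.inl (Or.inl ⟨1, r, r₁, r₂, h1, h2, h3, h4, rfl⟩)))
  · obtain ⟨r, r₁, r₂, h1, h2, h3, rfl⟩ := hc
    exact AddSubgroup.subset_closure (Or.inl (Or.inl (Or.inr ⟨1, r, r₁, r₂, h1, h2, h3, rfl⟩)))
  · obtain ⟨r, r', Φ, Φ', h1, h2, h3, h4, h5, rfl⟩ := hc
    exact AddSubgroup.subset_closure (Or.inl (Or.inr ⟨1, r, r', Φ, Φ', h1, h2, h3, h4, h5, rfl⟩))
  · exact AddSubgroup.subset_closure (Or.inr hc)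

/-- `dimFilter 1` maps `M₁` into `M₁'`. [folklore] -/
theorem dimFilter_one_mem_M₁'_of_mem_M₁ {c : KZ.FormalRep} (hc : c ∈ M₁) : dimFilter 1 c ∈ M₁' := by
  refine AddSubgroup.closure_induction (fun g hg => ?_) (by simp [M₁'.zero_mem])
    (fun x y _ _ hx hy => by rw [map_add]; exact M₁'.add_mem hx hy)
    (fun x _ hx => by rw [map_neg]; exact M₁'.neg_mem hx) hc
  rcases hg with ((hg | hg) | hg) | hg
  · obtain ⟨n, r, r₁, r₂, h1, h2, h3, h4, rfl⟩ := hg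
    by_cases hn : n = 1
    · subst hn
      simp only [map_sub, dimFilter_of_self]
      exact AddSubgroup.subset_closure (Or.inl (Or.inl (Or.inl ⟨r, r₁, r₂, h1, h2, h3, h4, rfl⟩)))
    · simp [map_sub, dimFilter_of_ne hn, M₁'.zero_mem]
  · obtain ⟨n, r, r₁, r₂, h1, h2, h3, rfl⟩ := hg
    by_cases hn : n = 1
    · subst hn
      simp only [map_sub, dimFilter_of_self]
      exact AddSubgroup.subset_closure (Or.inl (Or.inl (Or.inr ⟨r, r₁, r₂, h1, h2, h3, rfl⟩)))
    · simp [map_sub, dimFilter_of_ne hn, M₁'.zero_mem]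
  · obtain ⟨n, r, r', Φ, Φ', h1, h2, h3, h4, h5, rfl⟩ := hg
    by_cases hn : n = 1
    · subst hn
      simp only [map_sub, dimFilter_of_self]
      exact AddSubgroup.subset_closure (Or.inl (Or.inr ⟨r, r', Φ, Φ', h1, h2, h3, h4, h5, rfl⟩))
    · simp [map_sub, dimFilter_of_ne hn, M₁'.zero_mem]
  · have hg' := hg
    obtain ⟨Δ, A, B, S, r₀₁, r₁₂, r₀₂, -, -, -, -, -, -, -, -, -, -, -, -, rfl⟩ := hg
    simp only [map_sub, map_add, dimFilter_of_self]
    exact AddSubgroup.subset_closure (Or.inr hg')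

/-- **Only dimension-one moves matter.** `RealOnePeriodRelations` is equivalent to its version whose
conclusion subgroup is generated by the dimension-ONE instances of rules 1a, 1b, 2 and the Green
generator: the moves are dimension-homogeneous, so the dimension filter `dimFilter 1` retracts `M₁`
onto `M₁'` and fixes `H₁`. (A prover may ignore all other dimensions.) [folklore] -/
theorem realOnePeriodRelations_iff_dimOne :
    RealOnePeriodRelations ↔ ∀ c : KZ.FormalRep, c ∈ H₁ → KZ.eval c = 0 → c ∈ M₁' := by
  rw [crux_iff]
  refine ⟨fun h c hc h0 => ?_, fun h c hc h0 => M₁'_le_M₁ (h c hc h0)⟩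
  rw [← dimFilter_one_eq_self_of_mem_H₁ hc]
  exact dimFilter_one_mem_M₁'_of_mem_M₁ (h c hc h0)

/-- **The crux restricted to dimension-one moves**: `CurvePeriodsTransfer` is equivalent to the transfer
INTO `M₁'`. [folklore] -/
theorem transfer_iff_dimOne :
    CurvePeriodsTransfer ↔
      (HuberWustholzCurvePeriods → ∀ c : KZ.FormalRep, c ∈ H₁ → KZ.eval c = 0 → c ∈ M₁') := by
  rw [transfer_iff', realOnePeriodRelations_iff_dimOne]

/-! ## §2 Rule (2) cannot be dropped from the conclusion subgroup -/

/-- The open unit cube of `ℝⁿ`, used as a window in every dimension for `KZ.restrictedEval`. [folklore] -/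
def cubeWindow (n : ℕ) : Set (Fin n → ℝ) := {z | ∀ i, z i ∈ Set.Ioo (0 : ℝ) 1}

/-- The cube window as a product set. [folklore] -/
theorem cubeWindow_eq_pi (n : ℕ) : cubeWindow n = Set.pi univ fun _ => Set.Ioo (0 : ℝ) 1 := by
  ext z; simp [cubeWindow]

/-- The cube window is measurable. [folklore] -/
theorem measurableSet_cubeWindow (n : ℕ) : MeasurableSet (cubeWindow n) := by
  rw [cubeWindow_eq_pi]
  exact MeasurableSet.univ_pi fun _ => measurableSet_Ioo

/-- In dimension one the cube window is the unit-interval domain. [folklore] -/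
theorem unitDom_inter_cubeWindow : unitDom ∩ cubeWindow 1 = unitDom := by
  ext z
  simp only [unitDom, cubeWindow, mem_inter_iff, mem_setOf_eq, Fin.forall_fin_one, and_self]

/-- On a 1-dimensional representation with domain `(0,1)` the cube-restricted evaluation is the
evaluation. [folklore] -/
theorem restrictedEval_cube_of_eq_eval (r : KZ.IntegralRep 1) (hd : r.domain = {z | z 0 ∈ Set.Ioo 0 1}) :
    KZ.restrictedEval cubeWindow (KZ.of r) = KZ.eval (KZ.of r) := by
  have h : r.domain ∩ cubeWindow 1 = r.domain := by rw [hd]; exact unitDom_inter_cubeWindow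
  rw [KZ.restrictedEval_of, h, KZ.eval_of]
  rfl

/-- The Green generator is killed by the cube-restricted evaluation (its three domains ARE the window,
and it is sound — sibling file `GreenSound`). [folklore] -/
theorem restrictedEval_cube_eq_zero_of_mem_greenSet {g : KZ.FormalRep} (hg : g ∈ greenSet) :
    KZ.restrictedEval cubeWindow g = 0 := by
  have h0 := eval_eq_zero_of_mem_greenSet hg
  obtain ⟨Δ, A, B, S, r₀₁, r₁₂, r₀₂, -, -, -, -, -, -, hd₁, hd₂, hd₃, -, -, -, rfl⟩ := hg
  rw [map_sub, map_add, restrictedEval_cube_of_eq_eval r₀₁ hd₁, restrictedEval_cube_of_eq_eval r₁₂ hd₂,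
    restrictedEval_cube_of_eq_eval r₀₂ hd₃, ← map_add, ← map_sub]
  exact h0

/-- **`closure (1a ∪ 1b ∪ Green) ≤ ker (restrictedEval cubeWindow)`**: the additivity moves preserve
every windowed evaluation (tree `KZ.restrictedEval_eq_zero_of_mem_*`), and Green is killed by the
unit-cube window. Change of variables is NOT. [folklore] -/
theorem closure_add_green_le_ker_restrictedEval :
    AddSubgroup.closure (KZ.domainAddRel ∪ KZ.integrandAddRel ∪ greenSet) ≤
      (KZ.restrictedEval cubeWindow).ker := by
  refine (AddSubgroup.closure_le _).mpr ?_
  rintro c ((hc | hc) | hc) <;> rw [SetLike.mem_coe, AddMonoidHom.mem_ker]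
  · exact KZ.restrictedEval_eq_zero_of_mem_domainAddRel _ measurableSet_cubeWindow hc
  · exact KZ.restrictedEval_eq_zero_of_mem_integrandAddRel _ measurableSet_cubeWindow hc
  · exact restrictedEval_cube_eq_zero_of_mem_greenSet hc

/-- The interval `(0,2)` of `ℝ¹` is `ℚ`-semialgebraic. [folklore] -/
theorem isSemialgebraic_Ioo_two_fin_one : IsSemialgebraic ℚ {x : Fin 1 → ℝ | 0 < x 0 ∧ x 0 < 2} := by
  have h1 := Literature.ModelTheory.ExponentialFields.isSemialgebraic_setOf_eval_pos (k := ℚ)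
    (R := ℝ) (X 0 : MvPolynomial (Fin 1) ℚ)
  have h2 := Literature.ModelTheory.ExponentialFields.isSemialgebraic_setOf_eval_lt (k := ℚ)
    (R := ℝ) (X 0 : MvPolynomial (Fin 1) ℚ) (C 2 : MvPolynomial (Fin 1) ℚ)
  simp only [aeval_X, algHom_C] at h1 h2
  convert h1.inter h2 using 1
  ext x
  simp

/-- The interval `(0,2)` of `ℝ¹` has volume `2`. [folklore] -/
theorem volume_Ioo_two_fin_one : volume {x : Fin 1 → ℝ | 0 < x 0 ∧ x 0 < 2} = 2 := by
  have : {x : Fin 1 → ℝ | 0 < x 0 ∧ x 0 < 2} = Set.pi univ fun _ => Set.Ioo (0 : ℝ) 2 := by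
    ext x; simp [Fin.forall_fin_one]
  rw [this, Real.volume_pi_Ioo]
  simp

/-- The representation `[∫_{(0,2)} ½ dt]` (value `1`; the image of `[∫_{(0,1)} 1 dt]` under the scaling
`t ↦ 2t`, ONE change-of-variables instance). [cite: KontsevichZagier2001, §1.2 rule (2)] -/
def halfOnTwoRep : KZ.IntegralRep 1 where
  domain := {x : Fin 1 → ℝ | 0 < x 0 ∧ x 0 < 2}
  integrand := fun _ => ((1 / 2 : ℚ) : ℝ)
  isSemialgebraic_domain := isSemialgebraic_Ioo_two_fin_one
  isSemialgebraicFunOn_integrand := isSemialgebraicFunOn_ratConst isSemialgebraic_Ioo_two_fin_one (1 / 2)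
  integrableOn := integrableOn_const (by rw [volume_Ioo_two_fin_one]; exact ENNReal.ofNat_ne_top)

/-- `[∫_{(0,2)} ½]` has value `1`. [folklore] -/
@[simp] theorem value_halfOnTwoRep : halfOnTwoRep.value = 1 := by
  rw [KZ.IntegralRep.value]
  change ∫ x in {x : Fin 1 → ℝ | 0 < x 0 ∧ x 0 < 2}, (((1 / 2 : ℚ) : ℝ)) = 1
  rw [setIntegral_const]
  simp only [Measure.real, volume_Ioo_two_fin_one]
  norm_num

/-- The cube-restricted value of `[∫_{(0,2)} ½]` is `½`. [folklore] -/
theorem restrictedEval_cube_halfOnTwoRep : KZ.restrictedEval cubeWindow (KZ.of halfOnTwoRep) = 1 / 2 := by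
  rw [KZ.restrictedEval_of]
  have h : halfOnTwoRep.domain ∩ cubeWindow 1 = unitDom := by
    ext x
    simp only [halfOnTwoRep, cubeWindow, unitDom, mem_inter_iff, mem_setOf_eq, Fin.forall_fin_one,
      Set.mem_Ioo]
    constructor
    · rintro ⟨⟨h1, -⟩, -, h3⟩; exact ⟨h1, h3⟩
    · rintro ⟨h1, h3⟩; exact ⟨⟨h1, by linarith⟩, h1, h3⟩
  rw [h]
  change ∫ x in unitDom, (((1 / 2 : ℚ) : ℝ)) = 1 / 2
  rw [setIntegral_const]
  simp only [Measure.real, volume_unitDom]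
  norm_num

/-- The cube-restricted value of `[∫_{(0,1)} 1]` is `1`. [folklore] -/
theorem restrictedEval_cube_constRep₁_one : KZ.restrictedEval cubeWindow (KZ.of (constRep₁ 1)) = 1 := by
  rw [restrictedEval_cube_of_eq_eval (constRep₁ 1) rfl, KZ.eval_of, value_constRep₁]
  norm_num

/-- **Rule (2) cannot be dropped from the conclusion of `RealOnePeriodRelations`**: the combination
`[∫_{(0,2)} ½] − [∫_{(0,1)} 1]` (itself ONE change-of-variables instance, `t ↦ 2t`) lies in `H₁` and
evaluates to `0`, but it is separated from `closure (1a ∪ 1b ∪ Green)` by the unit-cube-restricted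
evaluation (`½ − 1 ≠ 0`). So the subcalculus "additivity + Green" is NOT complete in dimension one: any
proof of the consequent (hence of the crux) uses rule (2). [folklore] -/
theorem consequent_false_without_changeOfVariables :
    ¬ (∀ c : KZ.FormalRep, c ∈ H₁ → KZ.eval c = 0 →
        c ∈ AddSubgroup.closure (KZ.domainAddRel ∪ KZ.integrandAddRel ∪ greenSet)) := by
  intro h
  have hmem : KZ.of halfOnTwoRep - KZ.of (constRep₁ 1) ∈ H₁ :=
    H₁.sub_mem (AddSubgroup.subset_closure ⟨halfOnTwoRep, rfl⟩)
      (AddSubgroup.subset_closure ⟨constRep₁ 1, rfl⟩)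
  have h0 : KZ.eval (KZ.of halfOnTwoRep - KZ.of (constRep₁ 1)) = 0 := by
    rw [map_sub, KZ.eval_of, KZ.eval_of, value_halfOnTwoRep, value_constRep₁]
    norm_num
  have hk := closure_add_green_le_ker_restrictedEval (h _ hmem h0)
  rw [AddMonoidHom.mem_ker, map_sub, restrictedEval_cube_halfOnTwoRep, restrictedEval_cube_constRep₁_one]
    at hk
  norm_num at hk

end Summit.KontsevichZagierPeriods.SymplecticScissors.CurvePeriodsTransferNegative

end
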